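import Literature.MathematicalPhysics.QuantumFieldTheory.Balaban1983to89.B12FormatPlus

/-!
# NODE O port, row PT-A′ helper lane (PTZ-1): the (L♭) ⟹ (L) glue at the MOULD level — an analytic family of piece systems in the history
# multiplier, (1.18)-bounded by `C` on the disc `|z| < R` and vanishing at `z = 0`, has its `z = 1` member (1.18)-bounded by `C∕R` (Schwarz);
# in the `FormatPlusG` vehicle this is the difference functional's format `(C∕Ē′)·E` from ONE bound at the input scale `Ē′`

[Balaban1988RG2Cluster] = [II] (CMP 116, 1988): (2.38)–(2.41) pp. 20–21 (Lemma 3's bound with `C₃` linear in the input format `E₀`; «O(1)C₃ε₁ ≤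
½E₀»); [Balaban1987RG1] = [I] (CMP 109, 1987): (1.18)–(1.19) p. 263.  Mathlib: the Schwarz lemma `Complex.dist_le_div_mul_dist_of_mapsTo_ball`.

Seat `ymgap-nodeO-port-PTZ-1` g0 (prover, HELPER MODE; every file `--supports stmt-QuantumFields-27930 --as helper`; nothing keyed to 26648).  The
NODE-O lens seat `ymgap-nodeO-lens-2` typed the history-channel contraction (L) of the zero-input split and its PROOF ROUTE (L♭) «fixed-scale Schwarz»
(CRIT-1 g32: «M, print-derived»; lens-2 TYPING BRIEF v2 §3–§4; Sketch v9.2 `Cruxes/…/Lens2G6HistMulWindowSketch.lean` §2 `bound118_of_schwarz` :420,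
`dChannelContraction_of_flat` :491) in crux workfiles, which a Theorems file cannot import.  This module re-homes the mould-level step in the
`FormatPlusG` vehicle of record: §1 `bound118_of_schwarz` (lens-2's text verbatim, attributed); §2 `formatPlusG_of_flatFamily` — a `z`-family
`Ez : ℂ → Pieces S M` whose `z = 1` member carries the analyticity ∕ (1.7) ∕ (S1)-for-`Ψ` ∕ two-volume ∕ (1.19) rows, which is differentiable in `z`
on `Metric.ball 0 R` (`1 < R`) at every admissible coordinate point, (1.18)-bounded by ONE constant `C` there, and vanishes at `z = 0`, gives
`FormatPlusG … Ψ … (C ∕ R) κ`; `formatPlusG_of_flatFamily_scale` — the same written with `R := Ē′ ∕ E` (`0 < E < Ē′`): format `(C ∕ Ē′)·E`, i.e.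
(L)'s consequent with the `E`-free slope `ρ := C ∕ Ē′` (print's R23 letter at scale `Ē′`, lens-2 §1 `schwarzSlope_eq`).  Every slot is a variable
(χ, ι, `act`, `Uc`, … BOUND): selection-FREE (CRIT-1 Q-5 (β)).

HONEST FRAMING.  Complex-analysis bookkeeping over the mould; the EXISTENCE of such a family for the record's difference functional (the `z·𝐄_k`
pencil through the step, [II] Lemmas 1–3 under the history multiplier) is (L)'s content and is NOT asserted, ported or discharged here; 26648
UNSIGNED, 27930⁷ ∕ 27931⁷ OPEN; K0⁷ ∕ stub 2′ OPEN; counts unmoved; finite 𝕋⁴ at fixed ε — NOT continuum ∕ OS ∕ Clay; the Yang–Mills mass gap is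
NOT proved by any of this.  No `sorry`, no `instance`, no `notation`, no `def`.
-/

noncomputable section

namespace Summit.QuantumFields.YangMills.Theorems.PortZDSplit

open Literature.MathematicalPhysics.QuantumFieldTheory.Balaban1983to89
open Literature.MathematicalPhysics.QuantumFieldTheory.Balaban1983to89.B12FormatPlus
open _root_.Filter _root_.Topology

/-! ## §1. Schwarz ⟹ the (1.18) row contracts linearly in the history multiplier (lens-2 Sketch v9.2 §2 :420, re-homed verbatim) -/

/-- **Schwarz ⇒ the (1.18) row contracts linearly in the history scale**: a `z`-family of piece systems, differentiable in `z` on `|z| < R` (`R > 1`) at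
every admissible coordinate point, (1.18)-bounded by `C` uniformly on the disc, vanishing at `z = 0`, has its `z = 1` member (1.18)-bounded by `C∕R`
(lens-2 Sketch v9.2 §2 `bound118_of_schwarz`, text verbatim). [cite: Balaban1988RG2Cluster, (2.38)–(2.41) pp.20–21 (mechanism)] -/
theorem bound118_of_schwarz {S : ℕ → LocDomainSys} {M : ℕ → ℕ} (Uc : (n : ℕ) → (S n).Dom → Set (Fin (M n) → ℂ))
    (Ez : ℂ → Pieces S M) {R C κ : ℝ} (hR : 1 < R)
    (hd : ∀ n X u, u ∈ Uc n X → DifferentiableOn ℂ (fun z => Ez z n X u) (Metric.ball 0 R))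
    (hb : ∀ z ∈ Metric.ball (0 : ℂ) R, Bound118 S Uc (Ez z) C κ)
    (h0 : ∀ n X u, u ∈ Uc n X → Ez 0 n X u = 0) :
    Bound118 S Uc (Ez 1) (C / R) κ := by
  intro n X u hu
  have h1 : (1 : ℂ) ∈ Metric.ball (0 : ℂ) R := by
    rw [Metric.mem_ball, dist_zero_right, norm_one]; exact hR
  have hmaps : Set.MapsTo (fun z => Ez z n X u) (Metric.ball 0 R)
      (Metric.closedBall ((fun z => Ez z n X u) 0) (C * Real.exp (-κ * (S n).dj X))) := by
    intro z hz
    show dist (Ez z n X u) (Ez 0 n X u) ≤ C * Real.exp (-κ * (S n).dj X)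
    rw [h0 n X u hu, dist_zero_right]
    exact hb z hz n X u hu
  have hS := Complex.dist_le_div_mul_dist_of_mapsTo_ball (hd n X u hu) hmaps h1
  have hS' : dist (Ez 1 n X u) (Ez 0 n X u) ≤ C * Real.exp (-κ * (S n).dj X) / R * dist (1 : ℂ) 0 := hS
  rw [h0 n X u hu, dist_zero_right, dist_zero_right, norm_one, mul_one] at hS'
  calc ‖Ez 1 n X u‖ ≤ C * Real.exp (-κ * (S n).dj X) / R := hS'
    _ = C / R * Real.exp (-κ * (S n).dj X) := by ring

/-! ## §2. In the `FormatPlusG` vehicle: a flat family ⟹ the format of its `z = 1` member with the Schwarz constant -/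

section Mould

variable {S : ℕ → LocDomainSys} {M m : ℕ → ℕ} {G : ℕ → Type*} {act : (n : ℕ) → G n → (Fin (M n) → ℂ) → (Fin (M n) → ℂ)}
  {Uc : (n : ℕ) → (S n).Dom → Set (Fin (M n) → ℂ)} {coords : (n : ℕ) → (S n).Dom → Finset (Fin (M n))}
  {χ : (n : ℕ) → (S n).Dom → (Fin (m n) → ℂ) → (Fin (M n) → ℂ)} {W : ℕ → Type*} [∀ n, TopologicalSpace (W n)]
  [∀ n, Zero (W n)] {Ψ : (n : ℕ) → W n → ℂ} {ι : (n : ℕ) → W n → (Fin (m n) → ℂ)}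
  {wrap : (n : ℕ) → Finset (S n).Dom} {emb : (n : ℕ) → (S n).Dom → (S (n + 1)).Dom}
  {πc : (n : ℕ) → (S n).Dom → (Fin (M (n + 1)) → ℂ) → (Fin (M n) → ℂ)}

/-- **(L♭) ⟹ (L) AT ONE LEVEL, IN THE `FormatPlusG` VEHICLE**: a `z`-family `Ez` of piece systems whose `z = 1` member is analytic, local, represents the
functional `Ψ` near `0`, is volume-independent and (1.19)-invariant, which is `z`-differentiable on `|z| < R` (`1 < R`) at every admissible point,
(1.18)-bounded by `C` on the disc and vanishing at `z = 0`, puts `Ψ` in format `C∕R` — the six rows of `FormatPlusG` for the pieces `Ez 1`.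
[cite: Balaban1987RG1, (1.18)–(1.19) p.263; Balaban1988RG2Cluster, (2.38)–(2.41) pp.20–21 (mechanism)] -/
theorem formatPlusG_of_flatFamily (Ez : ℂ → Pieces S M) {R C κ : ℝ} (hR : 1 < R)
    (hA : Analytic19 Uc (Ez 1)) (hL : Local17 coords (Ez 1)) (hRep : Repr17 S (Ez 1) χ Ψ ι)
    (hV : PieceVolIndep S M wrap emb πc (Ez 1)) (hG : GaugeInv119 act Uc (Ez 1))
    (hd : ∀ n X u, u ∈ Uc n X → DifferentiableOn ℂ (fun z => Ez z n X u) (Metric.ball 0 R))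
    (hb : ∀ z ∈ Metric.ball (0 : ℂ) R, Bound118 S Uc (Ez z) C κ)
    (h0 : ∀ n X u, u ∈ Uc n X → Ez 0 n X u = 0) :
    FormatPlusG S M act Uc coords m χ Ψ ι wrap emb πc (C / R) κ :=
  ⟨Ez 1, hA, bound118_of_schwarz Uc Ez hR hd hb h0, hL, hRep, hV, hG⟩

/-- **The same at the input scale `Ē′`** (lens-2 `dChannelContraction_of_flat`, one level): with the disc radius `R := Ē′∕E` for a history format
`0 < E < Ē′` (the scaled history `z·𝐄_k` has format `|z|·E < Ē′` — Theorem 3's input range at ONE scale), the `z = 1` member has format `(C∕Ē′)·E`: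
(L)'s consequent with the `E`-FREE slope `ρ := C∕Ē′`. [cite: Balaban1988RG2Cluster, (2.38)–(2.41) pp.20–21, p.21 L16–20; Balaban1987RG1, (1.18) p.263] -/
theorem formatPlusG_of_flatFamily_scale (Ez : ℂ → Pieces S M) {E Ē' C κ : ℝ} (hE : 0 < E) (hEĒ : E < Ē')
    (hA : Analytic19 Uc (Ez 1)) (hL : Local17 coords (Ez 1)) (hRep : Repr17 S (Ez 1) χ Ψ ι)
    (hV : PieceVolIndep S M wrap emb πc (Ez 1)) (hG : GaugeInv119 act Uc (Ez 1))
    (hd : ∀ n X u, u ∈ Uc n X → DifferentiableOn ℂ (fun z => Ez z n X u) (Metric.ball 0 (Ē' / E)))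
    (hb : ∀ z ∈ Metric.ball (0 : ℂ) (Ē' / E), Bound118 S Uc (Ez z) C κ)
    (h0 : ∀ n X u, u ∈ Uc n X → Ez 0 n X u = 0) :
    FormatPlusG S M act Uc coords m χ Ψ ι wrap emb πc (C / Ē' * E) κ := by
  have hR1 : 1 < Ē' / E := by rw [lt_div_iff₀ hE]; linarith
  have h := formatPlusG_of_flatFamily Ez hR1 hA hL hRep hV hG hd hb h0
  have hEq : C / (Ē' / E) = C / Ē' * E := by field_simp
  rwa [hEq] at h

end Mould

end Summit.QuantumFields.YangMills.Theorems.PortZDSplit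

end
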